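import Summits.Ventures.CertifiedArithmetic.LowPrec.DoubleRoundingProductCells
import Summits.Ventures.CertifiedArithmetic.LowPrec.DoubleRoundingSlip

/-!
# Double rounding of the fused multiply-add (THEOREM D-fma, every pair of records)

HONEST FRAMING: certified error envelopes and provably optimal rounding/accumulation schemes for
low-precision formats under stated cost models; every table by two implementations; no hardware
or vendor claims.

`DFma(φ, ψ)`: for all finite `a b c` of `φ`, `fl_φ (fl_ψ (a·b + c)) = fl_φ (a·b + c)` — ONE
round-to-nearest-even of the exact `a·b + c` into the wider format `ψ` (a fused multiply-add
executed in `ψ`), converted to `φ`, equals the correctly rounded FMA of `φ` (both roundings the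
saturating RNE `roundNE` of this packet, subnormals kept).

## THE WINDOW CLAUSE (F) — `dFma_of_windows`, for EVERY pair of format records

If `F_φ ⊆ F_ψ` (`embedsTest`), `P_ψ ≥ 2 P_φ` (`2·m_φ + 1 ≤ m_ψ`), `bias_φ ≤ bias_ψ`,
`L_ψ ≤ 2 L_φ` (`qexp ψ ≤ 2 qexp φ`: `quantum ψ ∣ (quantum φ)²`), `L_ψ + P_ψ ≤ L_φ`
(`qexp ψ + m_ψ + 1 ≤ qexp φ`: half a quantum of `φ` is a NORMAL magnitude of `ψ`),
WINDOW A EMPTY `M_φ < 2^P_ψ` (`maxScaled φ < 2^(m_ψ+1)`: no midpoint `m` of `φ` has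
`½ ulp_ψ(m) ≥ quantum φ`), and WINDOW B EMPTY-OR-MOOT (`P_ψ ≥ 3 P_φ`, or
`maxRat φ < 2^(P_ψ + 2 L_φ)`), then `DFma(φ, ψ)`.

ANATOMY OF A SLIP (the proof; `fma_slip_core` is its integer heart). A slip at `x = a·b + c > 0`
forces (`slip_midpoint_of_pos`) `fl_ψ x = m`, the midpoint of two neighbours `v < u = v + G` of
`φ`, `x ≠ m`. In units `ν = ½ quantum ψ`: `a·b = P ν` with `2^k ∥ P`, `|P| ≤ (2^P_φ - 1)² 2^k`
(odd parts of the significands); `c = C ν`, `2^(D+1) ∣ C` (`quantum φ = 2^D quantum ψ`);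
`m = M ν`, `M = (2J+1)·2^g`, `2^g ν = G/2`; `m` is normal in `ψ` with `½ ulp_ψ(m) = 2^t ν`, so
`0 < |P + C - M| ≤ 2^t`, while `c ∈ F_φ` lies outside `(v, u)`: `|C - M| ≥ 2^g > 2^t`. With
`2^w ∥ C - M`: if `w ≤ k` then `2^w ∣ P + C - M`, `w ≤ t < g`, `2^(w+1) ∣ M`, `2^(w+1) ∤ C` —
impossible once `t ≤ D` (WINDOW A EMPTY: `m < maxRat φ < 2^P_ψ quantum φ`); if `w > k` then
`2^k ∥ P + C - M`, `k ≤ t`, and `2^g ≤ |C - M| ≤ (1 + (2^P_φ - 1)²) 2^t < 2^(t + 2 P_φ)` — with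
`g ≥ t + P_ψ - P_φ + 1` this needs `P_ψ < 3 P_φ`, and `k ≤ t` puts `m` in WINDOW B
(`m ≥ 2^(P_ψ + 2 L_φ)`). Signs go by the oddness of `roundNE`, `a·b = 0` by `F_φ ⊆ F_ψ`.

The named `13 × 13` matrix (clause cells, one kernel-checked witness per failing embedded cell)
is `DoubleRoundingFMAMatrix.lean`; implementation A is `code/enum/doublefma_decision.py` →
`DOUBLE-ROUNDING-FMA.md`. PLACEMENT: innocuous double rounding of `+ - × ÷ √` through a format
with `≥ 2p + 2` digits is classical [Figueroa1995, §3; Roux2014, §2] and is what simulators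
invoke [FasiMikaitis2023, §5]; for the FMA, [HighamPranesh2019, p. C589] asserts that
`chop(a + b*c)` computed in binary64 "will then be correctly rounded to the target precision"
for targets "single or less" — the window clause makes this precise: true iff the target's
finite range stays below `2^53` quanta (all FP4/FP6/FP8 records, binary16), false for bfloat16
and binary32 (`DoubleRoundingFMAMatrix.lean` §5, kernel witnesses). We found no statement of
the clause itself in the literature searched (queries in the cell's notes). No hardware or
vendor claims.
-/

namespace Summit.Ventures.CertifiedArithmetic

open Literature.ComputerArithmetic.FloatingPoint
open Literature.ComputerArithmetic.FloatingPoint.Format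
open Literature.ComputerArithmetic.FloatingPoint.MiniFloat

/-! ## §1 Integer lemmas -/

/-- Every nonzero integer has an exact power of two: `2^w ∣ n`, `2^(w+1) ∤ n`. [folklore] -/
theorem exists_two_pow_dvd_not_dvd {n : ℤ} (hn : n ≠ 0) :
    ∃ w : ℕ, (2:ℤ) ^ w ∣ n ∧ ¬ (2:ℤ) ^ (w + 1) ∣ n := by
  have h2w : ∀ i : ℕ, ((2:ℤ) ^ i).natAbs = 2 ^ i := fun i => by rw [Int.natAbs_pow]; rfl
  obtain ⟨w, m, hm, hnm⟩ := Nat.exists_eq_two_pow_mul_odd (Int.natAbs_ne_zero.mpr hn)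
  refine ⟨w, ?_, fun h => ?_⟩
  · have : ((2:ℤ) ^ w).natAbs ∣ n.natAbs := by rw [h2w, hnm]; exact Dvd.intro m rfl
    exact Int.natAbs_dvd_natAbs.mp this
  · have h2 : ((2:ℤ) ^ (w + 1)).natAbs ∣ n.natAbs := Int.natAbs_dvd_natAbs.mpr h
    rw [h2w, hnm, pow_succ] at h2
    exact hm.not_two_dvd_nat (Nat.dvd_of_mul_dvd_mul_left (by positivity) h2)

/-- The odd part of a nonzero significand is below `2^p`: `scaledMag = 2^α · a₁`, `a₁` odd,
`a₁ < 2^(m+1)`. [folklore] -/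
theorem exists_odd_part {φ : Format} (x : MiniFloat φ) (hx : x.scaledMag ≠ 0) :
    ∃ α a₁ : ℕ, Odd a₁ ∧ x.scaledMag = 2 ^ α * a₁ ∧ a₁ < 2 ^ (φ.manBits + 1) := by
  obtain ⟨α, a₁, hodd, hx1⟩ := Nat.exists_eq_two_pow_mul_odd hx
  obtain ⟨-, k, j, hk, hkj⟩ := representable_iff.mp (representable_scaledMag x)
  refine ⟨α, a₁, hodd, hx1, lt_of_le_of_lt ?_ hk⟩
  have hk0 : 0 < k := by
    refine Nat.pos_of_ne_zero fun h => hx ?_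
    rw [hkj, h, zero_mul]
  have hcop : Nat.Coprime a₁ (2 ^ j) :=
    Nat.Coprime.pow_right j
      (Nat.coprime_comm.mp ((Nat.prime_two.coprime_iff_not_dvd).mpr hodd.not_two_dvd_nat))
  have hdvd : a₁ ∣ k * 2 ^ j := by rw [← hkj, hx1]; exact Dvd.intro_left _ rfl
  exact Nat.le_of_dvd hk0 (hcop.dvd_of_dvd_mul_right hdvd)

/-- THE INTEGER HEART OF THEOREM D-fma. In units of half a quantum of the wide format: a
product `P` with `2^k ∥ P`, `|P| ≤ (2^p-1)²·2^k`, an addend `C` with `2^γ ∣ C`, a midpoint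
`M = (2J+1)·2^g` of the narrow format that is the correctly rounded wide result
(`0 < |P + C - M| ≤ 2^t`, `t < γ`, `t < g`) and an addend outside the gap (`|C - M| ≥ 2^g`) are
contradictory as soon as `t + 2p ≤ g` or `t < k`. [this packet] -/
theorem fma_slip_core {p k t g γ : ℕ} {P C M J : ℤ} (hp : 1 ≤ p)
    (hkP : (2:ℤ) ^ k ∣ P) (hkP' : ¬ (2:ℤ) ^ (k + 1) ∣ P) (hPle : |P| ≤ ((2:ℤ) ^ p - 1) ^ 2 * 2 ^ k)
    (hCγ : (2:ℤ) ^ γ ∣ C) (htγ : t < γ) (hM : M = (2 * J + 1) * 2 ^ g) (htg : t < g)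
    (hN0 : P + C - M ≠ 0) (hNle : |P + C - M| ≤ (2:ℤ) ^ t) (hfar : (2:ℤ) ^ g ≤ |C - M|)
    (hB : t + 2 * p ≤ g ∨ t < k) : False := by
  have le_of_two_pow_dvd : ∀ {w : ℕ} {n : ℤ}, n ≠ 0 → (2:ℤ) ^ w ∣ n → |n| ≤ 2 ^ t → w ≤ t := by
    intro w n hn hd hle
    exact (pow_le_pow_iff_right₀ (by norm_num : (1:ℤ) < 2)).mp
      ((Int.le_of_dvd (abs_pos.mpr hn) ((dvd_abs _ _).mpr hd)).trans hle)
  have hCM0 : C - M ≠ 0 := by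
    intro h0; rw [h0, abs_zero] at hfar; exact absurd hfar (not_le.mpr (by positivity))
  obtain ⟨w, hw, hw'⟩ := exists_two_pow_dvd_not_dvd hCM0
  have hPCM : P + (C - M) = P + C - M := by ring
  rcases Nat.lt_or_ge k w with hkw | hwk
  swap
  · have h1 : (2:ℤ) ^ w ∣ P := (pow_dvd_pow 2 hwk).trans hkP
    have h2 : (2:ℤ) ^ w ∣ P + C - M := hPCM ▸ dvd_add h1 hw
    have hwt : w ≤ t := le_of_two_pow_dvd hN0 h2 hNle
    have h4 : (2:ℤ) ^ (w + 1) ∣ M := by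
      rw [hM]; exact Dvd.dvd.mul_left (pow_dvd_pow 2 (by omega)) _
    have h5 : (2:ℤ) ^ (w + 1) ∣ C := (pow_dvd_pow 2 (by omega)).trans hCγ
    exact hw' (dvd_sub h5 h4)
  · have h1 : (2:ℤ) ^ (k + 1) ∣ C - M := (pow_dvd_pow 2 (by omega)).trans hw
    have h2 : (2:ℤ) ^ k ∣ P + C - M := hPCM ▸ dvd_add hkP ((pow_dvd_pow 2 hkw.le).trans hw)
    have h3 : ¬ (2:ℤ) ^ (k + 1) ∣ P + C - M := by
      intro h
      have e : P + C - M - (C - M) = P := by ring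
      exact hkP' (e ▸ dvd_sub h h1)
    have hkt : k ≤ t := le_of_two_pow_dvd hN0 h2 hNle
    rcases hB with hB | hB
    · have hPt : |P| ≤ ((2:ℤ) ^ p - 1) ^ 2 * 2 ^ t :=
        hPle.trans (mul_le_mul_of_nonneg_left (pow_le_pow_right₀ (by norm_num) hkt) (sq_nonneg _))
      have hCM : |C - M| ≤ 2 ^ t + ((2:ℤ) ^ p - 1) ^ 2 * 2 ^ t := by
        have e : C - M = (P + C - M) - P := by ring
        rw [e]; exact (abs_sub _ _).trans (add_le_add hNle hPt)
      have h2p : (2:ℤ) ≤ 2 ^ p := by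
        calc (2:ℤ) = 2 ^ 1 := by norm_num
          _ ≤ 2 ^ p := pow_le_pow_right₀ (by norm_num) hp
      have ht0 : (0:ℤ) < 2 ^ t := by positivity
      have hlt : 2 ^ t + ((2:ℤ) ^ p - 1) ^ 2 * 2 ^ t < 2 ^ (t + 2 * p) := by
        rw [pow_add, pow_mul']
        nlinarith [mul_pos ht0 (by linarith : (0:ℤ) < 2 * 2 ^ p - 2)]
      have hge : (2:ℤ) ^ (t + 2 * p) ≤ 2 ^ g := pow_le_pow_right₀ (by norm_num) hB
      exact absurd (lt_of_le_of_lt (hfar.trans hCM) hlt) (not_lt.mpr hge)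
    · omega

/-! ## §2 A correctly rounded normal result is within half its ulp -/

/-- If `fl_ψ x ≥ 0` is a NORMAL datum (`expCode ≥ 1`) below some value of `ψ`, then
`|x - fl_ψ x| ≤ ½ ulp(fl_ψ x) = 2^(expCode-1) · quantum / 2` (both neighbours of the result exist
and are no closer to `x`). [folklore; cite: MullerEtAl2018, §2.2.1] -/
theorem abs_sub_roundNE_le_half_ulp {ψ : Format} {x : ℚ} {z : MiniFloat ψ}
    (h0 : 0 ≤ (roundNE ψ x).toRat) (hz : (roundNE ψ x).toRat < z.toRat)
    (hE : 1 ≤ (roundNE ψ x).expCode) :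
    |x - (roundNE ψ x).toRat| ≤ 2 ^ ((roundNE ψ x).expCode - 1) * ψ.quantum / 2 := by
  set y := roundNE ψ x with hy
  have hB : (0:ℚ) < 2 ^ (y.expCode - 1) * ψ.quantum := by have := ψ.quantum_pos; positivity
  obtain ⟨u, hu⟩ := exists_toRat_eq_add_ulp h0 hz
  have hlow : 2 ^ (y.expCode - 1) ≤ y.scaledMag :=
    le_trans (Nat.pow_le_pow_right (by norm_num) (by omega)) (pow_le_scaledMag_of_expCode_pos y hE)
  obtain ⟨V, hV⟩ := pow_ulpExp_dvd_scaledMag y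
  have hdvd : 2 ^ (y.expCode - 1) ∣ y.scaledMag - 2 ^ (y.expCode - 1) :=
    ⟨V - 1, by rw [hV, Nat.mul_sub_one]⟩
  have hrep : ψ.Representable (y.scaledMag - 2 ^ (y.expCode - 1)) :=
    representable_of_pow_dvd (g := y.expCode - 1) hdvd
      ((Nat.sub_le _ _).trans (scaledMag_lt_pow_ulpExp y).le)
      ((Nat.sub_le _ _).trans y.scaledMag_le_maxScaled)
  obtain ⟨w, hw⟩ := exists_toRat_eq_intCast_mul (φ := ψ)
    ((y.scaledMag - 2 ^ (y.expCode - 1) : ℕ) : ℤ) (by rwa [Int.natAbs_natCast])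
  have hw' : w.toRat = y.toRat - 2 ^ (y.expCode - 1) * ψ.quantum := by
    rw [hw, toRat_eq_toInt_mul y, toInt_eq_scaledMag_of_nonneg h0]
    push_cast [Nat.cast_sub hlow]; ring
  rw [abs_le]
  constructor
  · by_cases hxw : w.toRat ≤ x
    · have h1 := roundNE_nearest x w
      rw [← hy, abs_of_nonneg (by linarith : 0 ≤ x - w.toRat)] at h1
      have h2 : y.toRat - x ≤ |x - y.toRat| := by rw [abs_sub_comm]; exact le_abs_self _
      linarith
    · have h1 := toRat_roundNE_mono (φ := ψ) (le_of_lt (not_le.mp hxw))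
      rw [toRat_roundNE_toRat, ← hy] at h1; exfalso; linarith
  · by_cases hxu : x ≤ u.toRat
    · have h1 := roundNE_nearest x u
      rw [← hy, abs_of_nonpos (by linarith : x - u.toRat ≤ 0)] at h1
      have h2 : x - y.toRat ≤ |x - y.toRat| := le_abs_self _
      linarith
    · have h1 := toRat_roundNE_mono (φ := ψ) (le_of_lt (not_le.mp hxu))
      rw [toRat_roundNE_toRat, ← hy] at h1; exfalso; linarith

/-! ## §3 The window clause -/

/-- THEOREM D-fma, positive inputs with a nonzero product: under the window clause a slip of
`fl_φ ∘ fl_ψ` at `x = a·b + c > 0` is impossible (the anatomy of the module docstring, reduced to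
`fma_slip_core`). [this packet] -/
theorem dFma_pos {φ ψ : Format} (hE : embedsTest φ ψ = true) (hm : 2 * φ.manBits + 1 ≤ ψ.manBits)
    (hb : φ.bias ≤ ψ.bias) (hq2 : ψ.qexp ≤ 2 * φ.qexp) (hnorm : ψ.qexp + ψ.manBits + 1 ≤ φ.qexp)
    (hwinA : φ.maxScaled < 2 ^ (ψ.manBits + 1))
    (hwinB : 3 * (φ.manBits + 1) ≤ ψ.manBits + 1 ∨
      φ.maxRat < (2:ℚ) ^ ((ψ.manBits : ℤ) + 1 + 2 * φ.qexp))
    {a b c : MiniFloat φ} (ha : a.scaledMag ≠ 0) (hb0 : b.scaledMag ≠ 0)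
    (hx : 0 < a.toRat * b.toRat + c.toRat) :
    (roundNE φ (roundNE ψ (a.toRat * b.toRat + c.toRat)).toRat).toRat
      = (roundNE φ (a.toRat * b.toRat + c.toRat)).toRat := by
  by_contra h
  set x := a.toRat * b.toRat + c.toRat with hxdef
  have hQφ := φ.quantum_pos; have hQ := ψ.quantum_pos
  have hq : ψ.qexp ≤ φ.qexp := by omega
  obtain ⟨zM, hzM⟩ := exists_toRat_eq_maxRat_of_test hE
  have hmax : φ.maxRat ≤ ψ.maxRat := hzM ▸ (le_abs_self _).trans (abs_toRat_le_maxRat zM)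
  -- the slip anatomy in `φ`: `fl_ψ x = m = (v+u)/2`, `u = v + G`
  obtain ⟨v, u, hv0, hvx, hxu, hgap, hmid, hxm⟩ := slip_midpoint_of_pos (by omega) hb hmax hx h
  set y := roundNE ψ x with hydef
  obtain ⟨u', hu'⟩ := exists_toRat_eq_add_ulp hv0 (hvx.trans hxu)
  have hule := add_ulp_le_of_lt hv0 (hvx.trans hxu)
  have hGpos : (0:ℚ) < 2 ^ (v.expCode - 1) * φ.quantum := by positivity
  have hueq : u.toRat = v.toRat + 2 ^ (v.expCode - 1) * φ.quantum := by
    rcases hgap u' with h1 | h1 <;> linarith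
  have hutop : u.toRat ≤ 2 ^ (φ.manBits + 1 + (v.expCode - 1)) * φ.quantum :=
    hueq ▸ toRat_add_ulp_le hv0
  have humax : u.toRat ≤ φ.maxRat := (le_abs_self _).trans (abs_toRat_le_maxRat u)
  have hyu : y.toRat < u.toRat := by rw [hmid]; linarith
  have hy0 : 0 ≤ y.toRat := by rw [hmid]; linarith
  -- quanta: `quantum φ = 2^D quantum ψ`, `quantum φ² = 2^S quantum ψ`, `ν = quantum ψ / 2`
  set D := (φ.qexp - ψ.qexp).toNat with hDdef
  have hDq : φ.quantum = 2 ^ D * ψ.quantum := quantum_eq_two_pow_mul hq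
  have hD1 : ψ.manBits + 1 ≤ D := by omega
  set S := (2 * φ.qexp - ψ.qexp).toNat with hSdef
  have hS0 : ((S : ℕ) : ℤ) = 2 * φ.qexp - ψ.qexp := by
    rw [hSdef]; exact Int.toNat_of_nonneg (by omega)
  have hSq : φ.quantum * φ.quantum = 2 ^ S * ψ.quantum := by
    unfold Format.quantum
    rw [← zpow_natCast, ← zpow_add₀ two_ne_zero, ← zpow_add₀ two_ne_zero, hS0]
    congr 1; ring
  set ν : ℚ := ψ.quantum / 2 with hνdef
  have hν : 0 < ν := by positivity
  have hQν : ψ.quantum = 2 * ν := by rw [hνdef]; ring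
  -- the integers
  have hyQ : y.toRat = (y.scaledMag : ℚ) * ψ.quantum := by
    rw [toRat_eq_toInt_mul, toInt_eq_scaledMag_of_nonneg hy0]; push_cast; rfl
  have hvQ : v.toRat = (v.scaledMag : ℚ) * φ.quantum := by
    rw [toRat_eq_toInt_mul, toInt_eq_scaledMag_of_nonneg hv0]; push_cast; rfl
  obtain ⟨V', hV'⟩ := pow_ulpExp_dvd_scaledMag v
  set g := (v.expCode - 1) + D with hgdef
  set M : ℤ := 2 * (y.scaledMag : ℤ) with hMdef
  have hmν : y.toRat = (M : ℚ) * ν := by rw [hyQ, hMdef, hQν]; push_cast; ring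
  have hGν : 2 ^ (v.expCode - 1) * φ.quantum = 2 * (2:ℚ) ^ g * ν := by
    rw [hDq, hQν, hgdef, pow_add]; ring
  have hMg : M = (2 * (V' : ℤ) + 1) * 2 ^ g := by
    have h1 : (M : ℚ) * ν = ((2 * (V' : ℤ) + 1) * 2 ^ g : ℤ) * ν := by
      rw [← hmν, hmid, hueq, hvQ, hV', hGν, hDq, hQν, hgdef]
      push_cast; ring
    exact_mod_cast mul_right_cancel₀ (ne_of_gt hν) h1
  -- the result is normal in `ψ`: `expCode ≥ 1`
  have hE1 : 1 ≤ y.expCode := by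
    by_contra h0
    have h0 : y.expCode = 0 := by omega
    have hlt : y.scaledMag < 2 ^ ψ.manBits := by
      have := y.man_lt; unfold scaledMag; rw [h0, Format.scaled_zero]; exact this
    have h1 : φ.quantum ≤ 2 ^ (v.expCode - 1) * φ.quantum :=
      le_mul_of_one_le_left hQφ.le (one_le_pow₀ (by norm_num))
    have h2 : (2:ℚ) ^ D * ψ.quantum ≤ (2 * y.scaledMag : ℚ) * ψ.quantum := by
      rw [← hDq, mul_assoc, ← hyQ, hmid, hueq]; linarith
    have h3 : (2 ^ D : ℕ) ≤ 2 * y.scaledMag := by exact_mod_cast le_of_mul_le_mul_right h2 hQ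
    have h4 : 2 ^ (ψ.manBits + 1) ≤ 2 ^ D := Nat.pow_le_pow_right (by norm_num) hD1
    rw [pow_succ] at h4; omega
  set t := y.expCode - 1 with htdef
  have hSy_lo : 2 ^ (ψ.manBits + t) ≤ y.scaledMag := pow_le_scaledMag_of_expCode_pos y hE1
  -- (a) correct rounding in `ψ`: `|x - m| ≤ 2^t ν`
  have hyz : y.toRat < zM.toRat := by rw [hzM]; linarith
  have habs : |x - y.toRat| ≤ 2 ^ t * ν := by
    have := abs_sub_roundNE_le_half_ulp hy0 hyz hE1
    rw [← hydef, hQν] at this; convert this using 1; rw [htdef]; ring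
  -- `x = (P + C) ν`, `c = C ν`
  set P : ℤ := a.toInt * b.toInt * 2 ^ (S + 1) with hPdef
  set C : ℤ := c.toInt * 2 ^ (D + 1) with hCdef
  have hxν : x = ((P + C : ℤ) : ℚ) * ν := by
    calc x = (a.toInt * b.toInt : ℚ) * (φ.quantum * φ.quantum) + c.toInt * φ.quantum := by
          rw [hxdef, toRat_eq_toInt_mul, toRat_eq_toInt_mul, toRat_eq_toInt_mul]; ring
      _ = (a.toInt * b.toInt : ℚ) * (2 ^ S * (2 * ν)) + c.toInt * (2 ^ D * (2 * ν)) := by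
          rw [hSq, hDq, hQν]
      _ = ((P + C : ℤ) : ℚ) * ν := by rw [hPdef, hCdef]; push_cast; ring
  have hcν : c.toRat = (C : ℚ) * ν := by
    rw [toRat_eq_toInt_mul, hCdef, hDq, hQν]; push_cast; ring
  -- `N = P + C - M ≠ 0`, `|N| ≤ 2^t`
  have hN0 : P + C - M ≠ 0 := by
    intro h0; apply hxm; rw [hxν, hmν]; congr 1; exact_mod_cast (sub_eq_zero.mp h0)
  have hNle : |P + C - M| ≤ (2:ℤ) ^ t := by
    have h1 : (|((P + C - M : ℤ) : ℚ)|) * ν ≤ (2:ℚ) ^ t * ν := by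
      rw [← abs_of_pos hν, ← abs_mul, abs_of_pos hν]
      have e : ((P + C - M : ℤ) : ℚ) * ν = x - y.toRat := by rw [hxν, hmν]; push_cast; ring
      rw [e]; exact habs
    exact_mod_cast le_of_mul_le_mul_right h1 hν
  -- `v = (M - 2^g) ν`, `u = (M + 2^g) ν`, hence `|C - M| ≥ 2^g`
  have hvν : v.toRat = ((M : ℚ) - 2 ^ g) * ν := by
    have e : v.toRat = y.toRat - 2 ^ (v.expCode - 1) * φ.quantum / 2 := by rw [hmid, hueq]; ring
    rw [e, hmν, hGν]; ring
  have huν : u.toRat = ((M : ℚ) + 2 ^ g) * ν := by rw [hueq, hvν, hGν]; ring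
  have hfar : (2:ℤ) ^ g ≤ |C - M| := by
    rcases hgap c with h1 | h1
    · rw [hcν, hvν] at h1
      have h3 : (C : ℤ) ≤ M - 2 ^ g := by exact_mod_cast le_of_mul_le_mul_right h1 hν
      rw [abs_sub_comm]; exact le_trans (by linarith) (le_abs_self _)
    · rw [hcν, huν] at h1
      have h3 : M + 2 ^ g ≤ (C : ℤ) := by exact_mod_cast le_of_mul_le_mul_right h1 hν
      exact le_trans (by linarith) (le_abs_self _)
  -- binade bookkeeping: `2^(m_ψ + t + 1) ≤ M < 2^(m_φ + 1 + g + 1)`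
  have hMlt : M < (2:ℤ) ^ (φ.manBits + 1 + g + 1) := by
    have h1 : (M : ℚ) * ν < (2:ℚ) ^ (φ.manBits + 1 + g + 1) * ν := by
      rw [← hmν]
      calc y.toRat < u.toRat := hyu
        _ ≤ 2 ^ (φ.manBits + 1 + (v.expCode - 1)) * φ.quantum := hutop
        _ = (2:ℚ) ^ (φ.manBits + 1 + g + 1) * ν := by
            rw [hDq, hQν, hgdef]; simp only [pow_add, pow_one]; ring
    exact_mod_cast lt_of_mul_lt_mul_right h1 hν.le
  have hMge : (2:ℤ) ^ (ψ.manBits + t + 1) ≤ M := by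
    have h1 : ((2 ^ (ψ.manBits + t) : ℕ) : ℤ) ≤ y.scaledMag := by exact_mod_cast hSy_lo
    push_cast at h1
    rw [hMdef, pow_succ]; linarith
  have hexp : ψ.manBits + t < φ.manBits + 1 + g := by
    have := (pow_lt_pow_iff_right₀ (by norm_num : (1:ℤ) < 2)).mp (hMge.trans_lt hMlt); omega
  have htg : t < g := by omega
  -- WINDOW A EMPTY ⇒ `t < D + 1`
  have htD : t < D + 1 := by
    have h1 : (M : ℚ) * ν < (2:ℚ) ^ (ψ.manBits + 1 + D + 1) * ν := by
      rw [← hmν]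
      calc y.toRat < φ.maxRat := lt_of_lt_of_le hyu humax
        _ = (φ.maxScaled : ℚ) * φ.quantum := rfl
        _ < ((2 ^ (ψ.manBits + 1) : ℕ) : ℚ) * φ.quantum :=
            mul_lt_mul_of_pos_right (by exact_mod_cast hwinA) hQφ
        _ = (2:ℚ) ^ (ψ.manBits + 1 + D + 1) * ν := by
            rw [hDq, hQν]; push_cast; simp only [pow_add, pow_one]; ring
    have h2 : M < (2:ℤ) ^ (ψ.manBits + 1 + D + 1) := by
      exact_mod_cast lt_of_mul_lt_mul_right h1 hν.le
    have := (pow_lt_pow_iff_right₀ (by norm_num : (1:ℤ) < 2)).mp (hMge.trans_lt h2); omega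
  -- WINDOW B EMPTY-OR-MOOT ⇒ `t + 2 P_φ ≤ g ∨ t < S + 1`
  have hB : t + 2 * (φ.manBits + 1) ≤ g ∨ t < S + 1 := by
    rcases hwinB with h3 | hB
    · left; omega
    · right
      have h1 : (M : ℚ) * ν < (2:ℚ) ^ (ψ.manBits + 1 + S + 1) * ν := by
        rw [← hmν]
        calc y.toRat < φ.maxRat := lt_of_lt_of_le hyu humax
          _ < (2:ℚ) ^ ((ψ.manBits : ℤ) + 1 + 2 * φ.qexp) := hB
          _ = (2:ℚ) ^ (ψ.manBits + 1 + S + 1) * ν := by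
              rw [hνdef]; unfold Format.quantum
              have e : (ψ.manBits : ℤ) + 1 + 2 * φ.qexp
                  = (((ψ.manBits + 1 + S + 1 : ℕ) : ℤ) - 1) + ψ.qexp := by
                push_cast; rw [hS0]; ring
              rw [e, zpow_add₀ two_ne_zero, zpow_sub₀ two_ne_zero, zpow_natCast, zpow_one]; ring
      have h2 : M < (2:ℤ) ^ (ψ.manBits + 1 + S + 1) := by
        exact_mod_cast lt_of_mul_lt_mul_right h1 hν.le
      have := (pow_lt_pow_iff_right₀ (by norm_num : (1:ℤ) < 2)).mp (hMge.trans_lt h2); omega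
  -- the product: `2^k ∥ P`, `|P| ≤ (2^P_φ - 1)² 2^k`, `k ≥ S + 1`
  obtain ⟨αa, a₁, ha₁, haα, ha₁lt⟩ := exists_odd_part a ha
  obtain ⟨αb, b₁, hb₁, hbα, hb₁lt⟩ := exists_odd_part b hb0
  set k := αa + αb + (S + 1) with hkdef
  have h2w : ∀ i : ℕ, ((2:ℤ) ^ i).natAbs = 2 ^ i := fun i => by rw [Int.natAbs_pow]; rfl
  have hPabs : P.natAbs = 2 ^ k * (a₁ * b₁) := by
    rw [hPdef, Int.natAbs_mul, Int.natAbs_mul, natAbs_toInt, natAbs_toInt, h2w, haα, hbα, hkdef]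
    simp only [pow_add]; ring
  have hkP : (2:ℤ) ^ k ∣ P := by
    rw [← Int.natAbs_dvd_natAbs, h2w, hPabs]; exact Dvd.intro _ rfl
  have hkP' : ¬ (2:ℤ) ^ (k + 1) ∣ P := by
    intro hd
    have h1 := Int.natAbs_dvd_natAbs.mpr hd
    rw [h2w, hPabs, pow_succ] at h1
    exact (Nat.odd_mul.mpr ⟨ha₁, hb₁⟩).not_two_dvd_nat
      (Nat.dvd_of_mul_dvd_mul_left (by positivity) h1)
  have hPle : |P| ≤ ((2:ℤ) ^ (φ.manBits + 1) - 1) ^ 2 * 2 ^ k := by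
    rw [Int.abs_eq_natAbs, hPabs]; push_cast
    have h1 : (a₁ : ℤ) + 1 ≤ 2 ^ (φ.manBits + 1) := by exact_mod_cast ha₁lt
    have h2 : (b₁ : ℤ) + 1 ≤ 2 ^ (φ.manBits + 1) := by exact_mod_cast hb₁lt
    have h12 : (a₁ : ℤ) * b₁ ≤ (2 ^ (φ.manBits + 1) - 1) ^ 2 := by
      rw [sq]; exact mul_le_mul (by linarith) (by linarith) (by positivity) (by linarith)
    rw [mul_comm]; exact mul_le_mul_of_nonneg_right h12 (by positivity)
  have hCγ : (2:ℤ) ^ (D + 1) ∣ C := by rw [hCdef]; exact dvd_mul_left _ _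
  have hB' : t + 2 * (φ.manBits + 1) ≤ g ∨ t < k := hB.imp_right (fun h => by omega)
  exact fma_slip_core (by omega) hkP hkP' hPle hCγ htD hMg htg hN0 hNle hfar hB'

/-- THEOREM D-fma, THE WINDOW CLAUSE (F), every pair of format records: `F_φ ⊆ F_ψ`,
`P_ψ ≥ 2 P_φ`, `bias_φ ≤ bias_ψ`, `L_ψ ≤ 2 L_φ`, `L_ψ + P_ψ ≤ L_φ`, `M_φ < 2^P_ψ` (window A empty)
and (`P_ψ ≥ 3 P_φ` or `maxRat φ < 2^(P_ψ + 2 L_φ)`, window B empty) imply that ONE fused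
multiply-add of `φ`-data executed in `ψ` and converted to `φ` is the correctly rounded FMA of `φ`.
Named cells: `DoubleRoundingFMAMatrix.lean`; A = `code/enum/doublefma_decision.py`. [this packet] -/
theorem dFma_of_windows {φ ψ : Format} (hE : embedsTest φ ψ = true)
    (hm : 2 * φ.manBits + 1 ≤ ψ.manBits) (hb : φ.bias ≤ ψ.bias) (hq2 : ψ.qexp ≤ 2 * φ.qexp)
    (hnorm : ψ.qexp + ψ.manBits + 1 ≤ φ.qexp) (hwinA : φ.maxScaled < 2 ^ (ψ.manBits + 1))
    (hwinB : 3 * (φ.manBits + 1) ≤ ψ.manBits + 1 ∨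
      φ.maxRat < (2:ℚ) ^ ((ψ.manBits : ℤ) + 1 + 2 * φ.qexp)) :
    ∀ a b c : MiniFloat φ, (roundNE φ (roundNE ψ (a.toRat * b.toRat + c.toRat)).toRat).toRat
      = (roundNE φ (a.toRat * b.toRat + c.toRat)).toRat := by
  intro a b c
  by_cases hab : a.scaledMag = 0 ∨ b.scaledMag = 0
  · have h0 : a.toRat * b.toRat = 0 := by
      rcases hab with h0 | h0 <;>
        simp [toRat_eq_toInt_mul a, toRat_eq_toInt_mul b, MiniFloat.toInt, h0]
    rw [h0, zero_add]
    exact toRat_roundNE_roundNE_of_exists (embeds_of_test hE c)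
  simp only [not_or] at hab
  rcases lt_trichotomy (a.toRat * b.toRat + c.toRat) 0 with hneg | h0 | hpos
  · have h := dFma_pos hE hm hb hq2 hnorm hwinA hwinB (a := a.flipSign) (b := b) (c := c.flipSign)
      hab.1 hab.2 (by simp only [toRat_flipSign]; linarith)
    simp only [toRat_flipSign] at h
    have e : -a.toRat * b.toRat + -c.toRat = -(a.toRat * b.toRat + c.toRat) := by ring
    rwa [e, toRat_roundNE_neg, toRat_roundNE_neg, toRat_roundNE_neg, neg_inj] at h
  · simp only [h0, toRat_roundNE_zero]
  · exact dFma_pos hE hm hb hq2 hnorm hwinA hwinB hab.1 hab.2 hpos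

end Summit.Ventures.CertifiedArithmetic
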